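import Mathlib
import Summits.KontsevichZagierPeriods.KontsevichZagierPeriods.Theorems.SoloInformedChartCore
import Summits.KontsevichZagierPeriods.KontsevichZagierPeriods.Theorems.SoloInformedCoonsBox
import Summits.KontsevichZagierPeriods.KontsevichZagierPeriods.Theorems.SoloInformedCoonsForm
import HarnessLib
/-!
# SoloInformed — edge coordinates and the cell functions of a Coons cell

File I2c₂b of the (HT) step (`SoloInformedNashHT`) of the solo-informed programme (support for the
Coons cell `soloInformed_kappaPath_coons`, file `SoloInformedCoonsCell`).

* the edge coordinate `c_X = (e_X)_{i₀}` of a map `e_X : ℝ → ℂⁿ` and its derivative, with their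
  calculus on a Nash neighbourhood (`SoloInformedNashOn`);
* the cell functions of four edges: the Coons patch `H(z) = h(z 0, z 1)` of the edge coordinates,
  its partials, and the real `1`-form coefficients `P = G(H) Hₛ`, `Q = G(H) Hₜ` with their line
  derivatives (`SoloInformedCoonsForm` with `G` the chart form of `SoloInformedChartCore`).

References: Huber–Wüstholz, *Transcendence and linear relations of 1-periods* (2022), §7.2.
-/

noncomputable section

open scoped BigOperators Topology
open Set Metric MvPolynomial
open Literature.NumberTheory.Transcendental Literature.NumberTheory.Transcendental.KZ
open Literature.NumberTheory.Transcendental.CurvePeriods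
open Literature.ModelTheory.ExponentialFields

namespace Summit.KontsevichZagierPeriods.KontsevichZagierPeriods.Theorems

/-! ## 4. Edge coordinates and the cell functions -/

variable {n : ℕ} {Z : CurveData}

/-- The `i₀`-coordinate `c_X = (e_X)_{i₀}` of a map `ℝ → ℂⁿ`. -/
def soloInformedEC (i₀ : Fin n) (e : ℝ → Fin n → ℂ) (u : ℝ) : ℂ := e u i₀

/-- Its derivative `c_X′`. -/
def soloInformedED (i₀ : Fin n) (e : ℝ → Fin n → ℂ) (u : ℝ) : ℂ := deriv (fun u => e u i₀) u

/-- `ψ(c_X(u)) = e_X(u)` for an edge point in the core of the chart. -/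
theorem SoloInformedChart.psi_EC (c : SoloInformedChart Z) {e : ℝ → Fin Z.n → ℂ} {u : ℝ}
    (hz : e u ∈ soloInformedCore c) : c.ψ (soloInformedEC c.i₀ e u) = e u :=
  c.psi_coord_of_mem_core hz

section NashEdge

variable {i₀ : Fin n} {e : ℝ → Fin n → ℂ} {ε : ℚ}

/-- The edge coordinate is differentiable on the Nash interval, with derivative `c_X′`. -/
theorem soloInformed_hasDerivAt_EC (h : SoloInformedNashOn ε e) {u : ℝ}
    (hu : u ∈ Ioo (-(ε : ℝ)) (1 + ε)) :
    HasDerivAt (soloInformedEC i₀ e) (soloInformedED i₀ e u) u :=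
  h.hasDerivAt hu i₀

/-- The edge coordinate is continuous on the Nash interval. -/
theorem soloInformed_continuousOn_EC (h : SoloInformedNashOn ε e) :
    ContinuousOn (soloInformedEC i₀ e) (Ioo (-(ε : ℝ)) (1 + ε)) :=
  h.continuousOn_apply i₀

/-- Its derivative is continuous on the Nash interval. -/
theorem soloInformed_continuousOn_ED (h : SoloInformedNashOn ε e) :
    ContinuousOn (soloInformedED i₀ e) (Ioo (-(ε : ℝ)) (1 + ε)) :=
  h.continuousOn_deriv i₀

/-- The edge coordinate is `ReImSA` on the Nash interval. -/
theorem soloInformed_reImSA_EC (h : SoloInformedNashOn ε e) :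
    SoloInformedReImSA (soloInformedIoo1 (-(ε : ℝ)) (1 + ε))
      (fun t => soloInformedEC i₀ e (t 0)) :=
  h.2 i₀

/-- Its derivative is `ReImSA` on the Nash interval. -/
theorem soloInformed_reImSA_ED (hε : 0 < ε) (h : SoloInformedNashOn ε e) :
    SoloInformedReImSA (soloInformedIoo1 (-(ε : ℝ)) (1 + ε))
      (fun t => soloInformedED i₀ e (t 0)) :=
  h.reImSA_deriv hε i₀

end NashEdge

section CellDefs

variable (i₀ : Fin n) (eB eT eL eR : ℝ → Fin n → ℂ)

/-- The Coons patch `h` of the edge coordinates, on `ℝ²`. -/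
def soloInformedCellH (z : Fin 2 → ℝ) : ℂ :=
  soloInformedCoons (soloInformedEC i₀ eB) (soloInformedEC i₀ eT) (soloInformedEC i₀ eL)
    (soloInformedEC i₀ eR) (z 0) (z 1)

/-- `∂ₛh` on `ℝ²`. -/
def soloInformedCellDs (z : Fin 2 → ℝ) : ℂ :=
  soloInformedCoonsDs (soloInformedEC i₀ eB) (soloInformedEC i₀ eT) (soloInformedEC i₀ eL)
    (soloInformedEC i₀ eR) (soloInformedED i₀ eB) (soloInformedED i₀ eT) (z 0) (z 1)

/-- `∂ₜh` on `ℝ²`. -/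
def soloInformedCellDt (z : Fin 2 → ℝ) : ℂ :=
  soloInformedCoonsDt (soloInformedEC i₀ eB) (soloInformedEC i₀ eT) (soloInformedED i₀ eL)
    (soloInformedED i₀ eR) (z 0) (z 1)

/-- `∂ₜ∂ₛh` on `ℝ²`. -/
def soloInformedCellDst (z : Fin 2 → ℝ) : ℂ :=
  soloInformedCoonsDst (soloInformedEC i₀ eB) (soloInformedEC i₀ eT) (soloInformedED i₀ eB)
    (soloInformedED i₀ eT) (soloInformedED i₀ eL) (soloInformedED i₀ eR) (z 0) (z 1)

end CellDefs

section CellForm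

variable (c : SoloInformedChart Z) (ω : Fin Z.n → MvPolynomial (Fin Z.n) ℂ)
  (eB eT eL eR : ℝ → Fin Z.n → ℂ)

/-- `G(h) ∂ₛh` (complex). -/
def soloInformedCellPc (z : Fin 2 → ℝ) : ℂ :=
  soloInformedCoonsPc (soloInformedChartForm c ω) (soloInformedEC c.i₀ eB) (soloInformedEC c.i₀ eT)
    (soloInformedEC c.i₀ eL) (soloInformedEC c.i₀ eR) (soloInformedED c.i₀ eB)
    (soloInformedED c.i₀ eT) z

/-- `G(h) ∂ₜh` (complex). -/
def soloInformedCellQc (z : Fin 2 → ℝ) : ℂ :=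
  soloInformedCoonsQc (soloInformedChartForm c ω) (soloInformedEC c.i₀ eB) (soloInformedEC c.i₀ eT)
    (soloInformedEC c.i₀ eL) (soloInformedEC c.i₀ eR) (soloInformedED c.i₀ eL)
    (soloInformedED c.i₀ eR) z

/-- `∂ₜ(G(h) ∂ₛh)` (complex). -/
def soloInformedCellPtc (z : Fin 2 → ℝ) : ℂ :=
  soloInformedCoonsPtc (soloInformedChartForm c ω) (deriv (soloInformedChartForm c ω))
    (soloInformedEC c.i₀ eB) (soloInformedEC c.i₀ eT) (soloInformedEC c.i₀ eL)
    (soloInformedEC c.i₀ eR) (soloInformedED c.i₀ eB) (soloInformedED c.i₀ eT)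
    (soloInformedED c.i₀ eL) (soloInformedED c.i₀ eR) z

/-- `∂ₛ(G(h) ∂ₜh)` (complex). -/
def soloInformedCellQsc (z : Fin 2 → ℝ) : ℂ :=
  soloInformedCoonsQsc (soloInformedChartForm c ω) (deriv (soloInformedChartForm c ω))
    (soloInformedEC c.i₀ eB) (soloInformedEC c.i₀ eT) (soloInformedEC c.i₀ eL)
    (soloInformedEC c.i₀ eR) (soloInformedED c.i₀ eB) (soloInformedED c.i₀ eT)
    (soloInformedED c.i₀ eL) (soloInformedED c.i₀ eR) z

/-- `G(h) ∂ₛh = G(h(z)) · ∂ₛh(z)`. -/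
theorem soloInformedCellPc_eq (z : Fin 2 → ℝ) :
    soloInformedCellPc c ω eB eT eL eR z =
      soloInformedChartForm c ω (soloInformedCellH c.i₀ eB eT eL eR z) *
        soloInformedCellDs c.i₀ eB eT eL eR z := rfl

/-- `G(h) ∂ₜh = G(h(z)) · ∂ₜh(z)`. -/
theorem soloInformedCellQc_eq (z : Fin 2 → ℝ) :
    soloInformedCellQc c ω eB eT eL eR z =
      soloInformedChartForm c ω (soloInformedCellH c.i₀ eB eT eL eR z) *
        soloInformedCellDt c.i₀ eB eT eL eR z := rfl

/-- `∂ₜ(G(h) ∂ₛh) = G′(h) ∂ₜh ∂ₛh + G(h) ∂ₜ∂ₛh`. -/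
theorem soloInformedCellPtc_eq (z : Fin 2 → ℝ) :
    soloInformedCellPtc c ω eB eT eL eR z =
      deriv (soloInformedChartForm c ω) (soloInformedCellH c.i₀ eB eT eL eR z) *
            soloInformedCellDt c.i₀ eB eT eL eR z * soloInformedCellDs c.i₀ eB eT eL eR z +
        soloInformedChartForm c ω (soloInformedCellH c.i₀ eB eT eL eR z) *
          soloInformedCellDst c.i₀ eB eT eL eR z := rfl

end CellForm

end Summit.KontsevichZagierPeriods.KontsevichZagierPeriods.Theorems
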